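/-
Copyright (c) 2026. All rights reserved.
Released under Apache 2.0 license as described in the file LICENSE.
Authors: abc-iut cell, prover seat abc-iut-f-066 (gen 8; row «C55iii-TELECORE@ARC+TWO-SIDED» (a2)(i), abc-iut-L4-lead m205 (2)),
after abc-iut-L4-t5's `LogFrobeniusSettingProd.lean` / `LogFrobeniusSettingProdObservables.lean` /
`LogFrobeniusSettingProdShiftAction.lean` (the product of two settings, its `ι⊞` componentwise, the component `HEq` forms of
«`ι⊞` over `Th•[Z]`») and abc-iut-L4-t3's `LogFrobeniusLamOverLink.lean` — every input consumed BY NAME; nothing restated.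
-/
import Literature.AnabelianGeometry.AbsoluteAnabelian.LogFrobeniusSettingProdShiftAction
import Literature.AnabelianGeometry.AbsoluteAnabelian.LogFrobeniusGenuineIotaOver
import Literature.AnabelianGeometry.AbsoluteAnabelian.LogFrobeniusObservablesTSOver
import HarnessLib

/-!
# The `TS`-valued homotopy datum of a PRODUCT of log-Frobenius settings; `IotaOver`, `LamOverLink`, `IotaOverTS` are inherited

S. Mochizuki, *Topics in absolute anabelian geometry III: global reconstruction algorithms* [MochizukiAbsTopIII2015];
locators `p.N` = pages of the author's manuscript (`paper:url-5493eb38cbb7`), read on the page: Def 5.4 (ii) p. 125 (the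
global `Th•_T[Z]`), Def 5.4 (iii)/(iv) pp. 126–127 (the `ι_{v,ε}` on `Γ⃗^log_v`, the `ι⊞_{v,ε}` on `Γ⃗^⋉_v`), Def 5.4 (vii)
p. 128 ("the arrow corresponding to `ε` lies over the identity of `Th•[Z]`"), Cor 5.5 p. 130.

DEFINITIONS + their bookkeeping (carrier data of the cell's construction; no `Prop`-valued reading of a printed sentence is
introduced).  abc-iut-L4-t5's `LogFrobeniusSetting.prod L₁ L₂` is the componentwise product of two settings over the same
`(V(F_mod), isArc)`; its `ι⊞_{v,ε}` is `eqToHom ≫ (ι⊞₁ × ι⊞₂)` (`frobeniusTwist_prod_comp`, `prod_iota_app_fst/snd`).  Here: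
* `prodTS T₁ T₂` — the `TS`-valued homotopy datum of the product built from `TS`-data of the factors the same way
  (`frobeniusTwistTS_prod_comp`; «`ι|_{Γ⃗^⋉} = ι⊞ ⋙ (𝒩⊞_v → 𝒩_v)`» componentwise), with `prodIotaTS_app_fst/snd`;
* `prod_lamOverLink` — «space-link and post-log vertices carry one over-structure» is inherited (`HEq` of `NatIso.prod`
  along each factor's `lam_spaceLink_eq_postLog`);
* `prod_iotaOver`, `prodTS_iotaOverTS` — «the `ι⊞` / `ι` lie over `Th•[Z]`» is inherited: by abc-iut-L4-t3's `IotaOver.of_app`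
  the printed equation is checked componentwise at each object, where — separately at a pre-log and at the post-log source,
  through abc-iut-L4-t3's `lamTwistOver_hom_app_heq_of_preLog/_of_postLog` — it is abc-iut-L4-t5's component computation
  `prod_toE_forget_iota_heq_of_preLog` and its post-log twin `prod_toE_forget_iota_heq_of_postLog` (added here; abc-iut-L4-t5
  typed the space-link form), resp. their `TS` analogues `prodTS_toE_iota_heq_of_preLog/_of_postLog`;
* the `TS`-data of the two factors of abc-iut-L4-t5's two-sided genuine setting `genuineTwoSided p 𝔄 V isArc =
  nonarchGenuineMonoAnPf.prod archGenuineMonoAnChart`, which the tree did not name: `nonarchGenuineMonoAnPfTS`,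
  `archGenuineMonoAnChartTS` — the holomorphic rows of these settings are DEFINITIONALLY those of abc-iut-w4-d095's
  `nonarchGenuineMono p` / `archGenuine 𝔄`, so the data are abc-iut-w4-d095's `nonarchIotaTS` / abc-iut-L4-t3's `archIotaTS` and
  `IotaOverTS` is their `nonarchGenuineMonoTS_iotaOverTS` / `archGenuineTS_iotaOverTS` read at the twin setting;
* `genuineTwoSidedTS`, `genuineTwoSided_iotaOver`, `genuineTwoSided_lamOverLink`, `genuineTwoSidedTS_iotaOverTS` — the inputs
  of abc-iut-L4-t5's Cor 5.5 (iii) sufficiency at ONE frozen setting carrying genuine rows at BOTH place types.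
HONEST LABEL: MODEL-LEVEL bookkeeping over OUR typed interface (the frozen `LogFrobeniusSetting`); refereed pre-IUT material;
nothing here bears on [IUTchIII] Cor. 3.12; no side taken; typed ≠ proved.
-/

set_option autoImplicit false

universe u

open CategoryTheory

namespace Literature.AnabelianGeometry.AbsoluteAnabelian

namespace LogFrobeniusSetting

open AbsTopIII

/-! ## §0. Bookkeeping in product categories -/

section Helpers

/-- an `eqToHom` prefix commutes into a functor application (bookkeeping). [folklore] -/
private theorem eqToHom_comp_map_eq {A B : Type*} [Category A] [Category B] (G : A ⥤ B) {a a' b : A} (e : a = a')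
    (f : a' ⟶ b) {e' : G.obj a = G.obj a'} : eqToHom e' ≫ G.map f = G.map (eqToHom e ≫ f) := by
  subst e
  simp

/-- a functor applied to an `eqToHom`-prefixed morphism keeps the heterogeneous class of its value (bookkeeping). [folklore] -/
private theorem heq_map_eqToHom_comp {A B : Type*} [Category A] [Category B] (G : A ⥤ B) {a a' b : A} (e : a = a')
    (f : a' ⟶ b) {c d : B} {g : c ⟶ d} (h : HEq (G.map f) g) : HEq (G.map (eqToHom e ≫ f)) g := by
  subst e
  simpa using h

/-- `HEq` of morphisms of a product category from the components (bookkeeping). [folklore] -/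
private theorem prodHom_heq {C D : Type*} [Category C] [Category D] {A B A' B' : C × D} (hA : A = A') (hB : B = B')
    {m : A ⟶ B} {n : A' ⟶ B'} (h₁ : HEq m.1 n.1) (h₂ : HEq m.2 n.2) : HEq m n := by
  subst hA hB
  exact heq_of_eq (Prod.hom_ext (eq_of_heq h₁) (eq_of_heq h₂))

/-- `HEq` of product isomorphisms along equations of their sources (bookkeeping). [folklore] -/
private theorem heq_natIsoProd {A B C D : Type*} [Category A] [Category B] [Category C] [Category D]
    {F F' G : A ⥤ B} {H H' K : C ⥤ D} (hF : F = F') (hH : H = H') {i : F ≅ G} {i' : F' ≅ G} {j : H ≅ K}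
    {j' : H' ≅ K} (hi : HEq i i') (hj : HEq j j') : HEq (NatIso.prod i j) (NatIso.prod i' j') := by
  subst hF hH
  cases hi
  cases hj
  rfl

end Helpers

/-! ## §1. A generic add-on: the `TS`-valued `ι` over `Th•[Z]` along a POST-log edge, componentwise -/

section Generic

variable {Vmod : Type u} {isArc : Vmod → Bool} {L : LogFrobeniusSetting Vmod isArc}

/-- Along a POST-log edge: `(𝒩_v → Th•[Z])(ι_{v,ε,X}) ≍ A_{ν₁, log X} ∘ Ξ_X ∘ A_{ν₂,X}⁻¹` (`A := lamOver`, `Ξ := logOver`) — the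
`TS` twin of abc-iut-L4-t3's `IotaOver.toE_map_iota_heq_of_postLog` (its `TS` file typed the pre-log and space-link forms).
[cite: MochizukiAbsTopIII2015, Def 5.4 (vii) p. 128] -/
theorem TSHomotopies.IotaOverTS.toE_map_iota_heq_of_postLog {T : L.TSHomotopies} (hι : T.IotaOverTS) (v : Vmod)
    {ν₁ ν₂ : LogVertex (isArc v)} (ε : LogEdgeTS (isArc v) ν₁ ν₂) (h₁ : ν₁.isPostLog = true) (X₀ : L.X) :
    HEq ((L.toE v).map ((T.iota v ε).app X₀))
      ((L.lamOver v ν₁).hom.app (L.log.obj X₀) ≫ L.logOver.hom.app X₀ ≫ (L.lamOver v ν₂).inv.app X₀) := by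
  rw [hι.app v ε X₀]
  have k : ((frobeniusTwist L.log ν₁.isPostLog ⋙ L.lam v ν₁) ⋙ L.forget v ⋙ L.toE v).obj X₀ =
      (L.lam v ν₁ ⋙ L.forget v ⋙ L.toE v).obj (L.log.obj X₀) := by
    rw [h₁]; rfl
  exact (heq_comp k rfl rfl (L.lamTwistOver_hom_app_heq_of_postLog v ν₁ h₁ X₀) HEq.rfl).trans
    (heq_of_eq (Category.assoc _ _ _))

end Generic

/-! ## §2. The `TS`-datum of a product -/

section Prod

variable {Vmod : Type u} {isArc : Vmod → Bool} (L₁ L₂ : LogFrobeniusSetting Vmod isArc)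

/-- The twisted source of the `TS`-valued `ι` in the product, pushed to `𝒩_v`, is the product of the factors' (stated, like
abc-iut-L4-t5's `frobeniusTwist_prod_comp`, between functors into the product category `𝒩₁_v × 𝒩₂_v`).
[cite: MochizukiAbsTopIII2015, Def 5.4 (vii) p. 128] -/
theorem frobeniusTwistTS_prod_comp (c : Bool) (v : Vmod) (ν : LogVertex (isArc v)) :
    (frobeniusTwist (L₁.log.prod L₂.log) c ⋙ (L₁.lam v ν).prod (L₂.lam v ν)) ⋙ (L₁.forget v).prod (L₂.forget v) =
      ((frobeniusTwist L₁.log c ⋙ L₁.lam v ν) ⋙ L₁.forget v).prod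
        ((frobeniusTwist L₂.log c ⋙ L₂.lam v ν) ⋙ L₂.forget v) := by
  cases c <;> rfl

variable (T₁ : L₁.TSHomotopies) (T₂ : L₂.TSHomotopies)

/-- `ι_{v,ε} := eqToHom ≫ (ι₁ × ι₂)` on an edge of `Γ⃗^log_v` (the datum of `prodTS`). [cite: MochizukiAbsTopIII2015, Def 5.4 (iii) p. 126] -/
noncomputable def prodIotaTS (v : Vmod) {ν₁ ν₂ : LogVertex (isArc v)} (ε : LogEdgeTS (isArc v) ν₁ ν₂) :
    ((frobeniusTwist (L₁.prod L₂).log ν₁.isPostLog ⋙ (L₁.prod L₂).lam v ν₁) ⋙ (L₁.prod L₂).forget v ⟶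
      (L₁.prod L₂).lam v ν₂ ⋙ (L₁.prod L₂).forget v) :=
  eqToHom (frobeniusTwistTS_prod_comp L₁ L₂ ν₁.isPostLog v ν₁) ≫ NatTrans.prod (T₁.iota v ε) (T₂.iota v ε)

/-- The FIRST component of the product's `TS`-valued `ι_{v,ε}` at an object is the first factor's.
[cite: MochizukiAbsTopIII2015, Def 5.4 (iii) p. 126] -/
theorem prodIotaTS_app_fst (v : Vmod) {ν₁ ν₂ : LogVertex (isArc v)} (ε : LogEdgeTS (isArc v) ν₁ ν₂)
    (x : (L₁.prod L₂).X) :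
    ((prodIotaTS L₁ L₂ T₁ T₂ v ε).app x).1 =
      eqToHom (congrArg Prod.fst (Functor.congr_obj (frobeniusTwistTS_prod_comp L₁ L₂ ν₁.isPostLog v ν₁) x)) ≫
        (T₁.iota v ε).app x.1 := by
  change ((eqToHom (frobeniusTwistTS_prod_comp L₁ L₂ ν₁.isPostLog v ν₁)).app x ≫
    (NatTrans.prod (T₁.iota v ε) (T₂.iota v ε)).app x).1 = _
  rw [prod_comp_fst, eqToHom_app, eqToHom_fst]
  rfl

/-- The SECOND component likewise. [cite: MochizukiAbsTopIII2015, Def 5.4 (iii) p. 126] -/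
theorem prodIotaTS_app_snd (v : Vmod) {ν₁ ν₂ : LogVertex (isArc v)} (ε : LogEdgeTS (isArc v) ν₁ ν₂)
    (x : (L₁.prod L₂).X) :
    ((prodIotaTS L₁ L₂ T₁ T₂ v ε).app x).2 =
      eqToHom (congrArg Prod.snd (Functor.congr_obj (frobeniusTwistTS_prod_comp L₁ L₂ ν₁.isPostLog v ν₁) x)) ≫
        (T₂.iota v ε).app x.2 := by
  change ((eqToHom (frobeniusTwistTS_prod_comp L₁ L₂ ν₁.isPostLog v ν₁)).app x ≫
    (NatTrans.prod (T₁.iota v ε) (T₂.iota v ε)).app x).2 = _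
  rw [prod_comp_snd, eqToHom_app, eqToHom_snd]
  rfl

/-- ★ **The `TS`-valued homotopy datum of the product of two settings**: `ι_{v,ε} := eqToHom ≫ (ι₁ × ι₂)` on every edge of
`Γ⃗^log_v`; on `Γ⃗^⋉_v` it is `ι⊞ ⋙ (𝒩⊞_v → 𝒩_v)` because it is so in each factor (checked componentwise with abc-iut-L4-t5's
`prod_iota_app_fst/snd`). [cite: MochizukiAbsTopIII2015, Def 5.4 (iii) p. 126] -/
noncomputable def prodTS : (L₁.prod L₂).TSHomotopies where
  iota v _ _ ε := prodIotaTS L₁ L₂ T₁ T₂ v ε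
  iota_toTS v ν₁ ν₂ ε := by
    ext x
    apply CategoryTheory.Prod.hom_ext
    · rw [prodIotaTS_app_fst, T₁.iota_toTS v ε, Functor.whiskerRight_app, Functor.whiskerRight_app]
      change _ = (L₁.forget v).map (((L₁.prod L₂).iota v ε).app x).1
      rw [prod_iota_app_fst]
      exact eqToHom_comp_map_eq (L₁.forget v) _ _
    · rw [prodIotaTS_app_snd, T₂.iota_toTS v ε, Functor.whiskerRight_app, Functor.whiskerRight_app]
      change _ = (L₂.forget v).map (((L₁.prod L₂).iota v ε).app x).2
      rw [prod_iota_app_snd]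
      exact eqToHom_comp_map_eq (L₂.forget v) _ _

/-- `ι_{v,ε}` of the product `TS`-datum, by definition. [cite: MochizukiAbsTopIII2015, Def 5.4 (iii) p. 126] -/
theorem prodTS_iota (v : Vmod) {ν₁ ν₂ : LogVertex (isArc v)} (ε : LogEdgeTS (isArc v) ν₁ ν₂) :
    (prodTS L₁ L₂ T₁ T₂).iota v ε = prodIotaTS L₁ L₂ T₁ T₂ v ε := rfl

/-! ## §3. `LamOverLink` is inherited -/

/-- ★ **`LamOverLink` is inherited by the product**: if in both factors the space-link and post-log vertices carry ONE
over-structure, so do they in the product (`λ` of the product is `λ₁ × λ₂`, «lies over» is `NatIso.prod`).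
[cite: MochizukiAbsTopIII2015, Cor 5.5 p. 130] -/
theorem prod_lamOverLink (h₁ : L₁.LamOverLink) (h₂ : L₂.LamOverLink) : (L₁.prod L₂).LamOverLink := fun v =>
  heq_natIsoProd (by rw [L₁.lam_spaceLink_eq_postLog v]) (by rw [L₂.lam_spaceLink_eq_postLog v]) (h₁ v) (h₂ v)

/-! ## §4. `IotaOver` is inherited -/

/-- **`ι⊞` of the product over `Th•[Z]` along a POST-log edge, componentwise** — the post-log twin of abc-iut-L4-t5's
`prod_toE_forget_iota_heq_spaceLink` WITHOUT the space-link detour (so no `LamOverLink` is needed): from `IotaOver` on both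
factors (abc-iut-L4-t3's `IotaOver.toE_map_iota_heq_of_postLog`). [cite: MochizukiAbsTopIII2015, Def 5.4 (vii) p. 128] -/
theorem prod_toE_forget_iota_heq_of_postLog (hι₁ : L₁.IotaOver) (hι₂ : L₂.IotaOver) (v : Vmod)
    {ν₁ ν₂ : LogVertex (isArc v)} (ε : LogEdge (isArc v) ν₁ ν₂) (h₁ : ν₁.isPostLog = true) (X₀ : (L₁.prod L₂).X) :
    HEq (((L₁.prod L₂).toE v).map (((L₁.prod L₂).forget v).map (((L₁.prod L₂).iota v ε).app X₀)))
      (((L₁.prod L₂).lamOver v ν₁).hom.app ((L₁.prod L₂).log.obj X₀) ≫ (L₁.prod L₂).logOver.hom.app X₀ ≫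
        ((L₁.prod L₂).lamOver v ν₂).inv.app X₀) := by
  have k : ((frobeniusTwist (L₁.prod L₂).log ν₁.isPostLog ⋙ (L₁.prod L₂).lam v ν₁) ⋙ (L₁.prod L₂).forget v ⋙
        (L₁.prod L₂).toE v).obj X₀ =
      ((L₁.prod L₂).lam v ν₁ ⋙ (L₁.prod L₂).forget v ⋙ (L₁.prod L₂).toE v).obj ((L₁.prod L₂).log.obj X₀) := by
    rw [h₁]; rfl
  apply prodHom_heq k rfl
  · change HEq (((L₁.forget v) ⋙ (L₁.toE v)).map (((L₁.prod L₂).iota v ε).app X₀).1) _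
    rw [prod_iota_app_fst]
    exact heq_map_eqToHom_comp _ _ _ (hι₁.toE_map_iota_heq_of_postLog v ε h₁ X₀.1)
  · change HEq (((L₂.forget v) ⋙ (L₂.toE v)).map (((L₁.prod L₂).iota v ε).app X₀).2) _
    rw [prod_iota_app_snd]
    exact heq_map_eqToHom_comp _ _ _ (hι₂.toE_map_iota_heq_of_postLog v ε h₁ X₀.2)

/-- ★ **`IotaOver` is inherited by the product**: if the `ι⊞` of both factors lie over `Th•[Z]`, the `ι⊞ = eqToHom ≫ (ι⊞₁ × ι⊞₂)`
of the product lie over `Th•[Z] = ℰ₁ × ℰ₂` (abc-iut-L4-t3's `IotaOver.of_app`; at a pre-log source abc-iut-L4-t5's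
`prod_toE_forget_iota_heq_of_preLog`, at the post-log source `prod_toE_forget_iota_heq_of_postLog`).
[cite: MochizukiAbsTopIII2015, Def 5.4 (vii) p. 128] -/
theorem prod_iotaOver (hι₁ : L₁.IotaOver) (hι₂ : L₂.IotaOver) : (L₁.prod L₂).IotaOver := by
  apply IotaOver.of_app
  intro v ν₁ ν₂ ε X₀
  obtain hb | hb := Bool.eq_false_or_eq_true ν₁.isPostLog
  · have k : ((frobeniusTwist (L₁.prod L₂).log ν₁.isPostLog ⋙ (L₁.prod L₂).lam v ν₁) ⋙ (L₁.prod L₂).forget v ⋙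
          (L₁.prod L₂).toE v).obj X₀ =
        ((L₁.prod L₂).lam v ν₁ ⋙ (L₁.prod L₂).forget v ⋙ (L₁.prod L₂).toE v).obj ((L₁.prod L₂).log.obj X₀) := by
      rw [hb]; rfl
    exact eq_of_heq ((prod_toE_forget_iota_heq_of_postLog L₁ L₂ hι₁ hι₂ v ε hb X₀).trans
      ((heq_comp k rfl rfl ((L₁.prod L₂).lamTwistOver_hom_app_heq_of_postLog v ν₁ hb X₀) HEq.rfl).trans
        (heq_of_eq (Category.assoc _ _ _))).symm)
  · have k : ((frobeniusTwist (L₁.prod L₂).log ν₁.isPostLog ⋙ (L₁.prod L₂).lam v ν₁) ⋙ (L₁.prod L₂).forget v ⋙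
          (L₁.prod L₂).toE v).obj X₀ =
        ((L₁.prod L₂).lam v ν₁ ⋙ (L₁.prod L₂).forget v ⋙ (L₁.prod L₂).toE v).obj X₀ := by
      rw [hb]; rfl
    exact eq_of_heq ((prod_toE_forget_iota_heq_of_preLog L₁ L₂ hι₁ hι₂ v ε hb X₀).trans
      (heq_comp k rfl rfl ((L₁.prod L₂).lamTwistOver_hom_app_heq_of_preLog v ν₁ hb X₀) HEq.rfl).symm)

/-! ## §5. `IotaOverTS` is inherited -/

variable {T₁ T₂}

/-- **The product's `TS`-valued `ι` over `Th•[Z]` along a PRE-log edge, componentwise.**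
[cite: MochizukiAbsTopIII2015, Def 5.4 (vii) p. 128] -/
theorem prodTS_toE_iota_heq_of_preLog (hT₁ : T₁.IotaOverTS) (hT₂ : T₂.IotaOverTS) (v : Vmod)
    {ν₁ ν₂ : LogVertex (isArc v)} (ε : LogEdgeTS (isArc v) ν₁ ν₂) (h₁ : ν₁.isPostLog = false) (X₀ : (L₁.prod L₂).X) :
    HEq (((L₁.prod L₂).toE v).map (((prodTS L₁ L₂ T₁ T₂).iota v ε).app X₀))
      (((L₁.prod L₂).lamOver v ν₁).hom.app X₀ ≫ ((L₁.prod L₂).lamOver v ν₂).inv.app X₀) := by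
  have k : (((frobeniusTwist (L₁.prod L₂).log ν₁.isPostLog ⋙ (L₁.prod L₂).lam v ν₁) ⋙ (L₁.prod L₂).forget v) ⋙
        (L₁.prod L₂).toE v).obj X₀ =
      (((L₁.prod L₂).lam v ν₁ ⋙ (L₁.prod L₂).forget v) ⋙ (L₁.prod L₂).toE v).obj X₀ := by
    rw [h₁]; rfl
  apply prodHom_heq k rfl
  · change HEq ((L₁.toE v).map (((prodTS L₁ L₂ T₁ T₂).iota v ε).app X₀).1) _
    rw [prodTS_iota, prodIotaTS_app_fst]
    exact heq_map_eqToHom_comp _ _ _ (hT₁.toE_map_iota_heq_of_preLog v ε h₁ X₀.1)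
  · change HEq ((L₂.toE v).map (((prodTS L₁ L₂ T₁ T₂).iota v ε).app X₀).2) _
    rw [prodTS_iota, prodIotaTS_app_snd]
    exact heq_map_eqToHom_comp _ _ _ (hT₂.toE_map_iota_heq_of_preLog v ε h₁ X₀.2)

/-- **The product's `TS`-valued `ι` over `Th•[Z]` along a POST-log edge, componentwise.**
[cite: MochizukiAbsTopIII2015, Def 5.4 (vii) p. 128] -/
theorem prodTS_toE_iota_heq_of_postLog (hT₁ : T₁.IotaOverTS) (hT₂ : T₂.IotaOverTS) (v : Vmod)
    {ν₁ ν₂ : LogVertex (isArc v)} (ε : LogEdgeTS (isArc v) ν₁ ν₂) (h₁ : ν₁.isPostLog = true) (X₀ : (L₁.prod L₂).X) :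
    HEq (((L₁.prod L₂).toE v).map (((prodTS L₁ L₂ T₁ T₂).iota v ε).app X₀))
      (((L₁.prod L₂).lamOver v ν₁).hom.app ((L₁.prod L₂).log.obj X₀) ≫ (L₁.prod L₂).logOver.hom.app X₀ ≫
        ((L₁.prod L₂).lamOver v ν₂).inv.app X₀) := by
  have k : (((frobeniusTwist (L₁.prod L₂).log ν₁.isPostLog ⋙ (L₁.prod L₂).lam v ν₁) ⋙ (L₁.prod L₂).forget v) ⋙
        (L₁.prod L₂).toE v).obj X₀ =
      (((L₁.prod L₂).lam v ν₁ ⋙ (L₁.prod L₂).forget v) ⋙ (L₁.prod L₂).toE v).obj ((L₁.prod L₂).log.obj X₀) := by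
    rw [h₁]; rfl
  apply prodHom_heq k rfl
  · change HEq ((L₁.toE v).map (((prodTS L₁ L₂ T₁ T₂).iota v ε).app X₀).1) _
    rw [prodTS_iota, prodIotaTS_app_fst]
    exact heq_map_eqToHom_comp _ _ _ (hT₁.toE_map_iota_heq_of_postLog v ε h₁ X₀.1)
  · change HEq ((L₂.toE v).map (((prodTS L₁ L₂ T₁ T₂).iota v ε).app X₀).2) _
    rw [prodTS_iota, prodIotaTS_app_snd]
    exact heq_map_eqToHom_comp _ _ _ (hT₂.toE_map_iota_heq_of_postLog v ε h₁ X₀.2)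

/-- ★ **`IotaOverTS` is inherited by the product `TS`-datum.** [cite: MochizukiAbsTopIII2015, Def 5.4 (vii) p. 128] -/
theorem prodTS_iotaOverTS (hT₁ : T₁.IotaOverTS) (hT₂ : T₂.IotaOverTS) : (prodTS L₁ L₂ T₁ T₂).IotaOverTS := by
  intro v ν₁ ν₂ ε
  ext X₀
  simp only [Functor.whiskerRight_app, NatTrans.comp_app, Functor.associator_hom_app, Functor.associator_inv_app]
  erw [Category.id_comp, Category.comp_id]
  obtain hb | hb := Bool.eq_false_or_eq_true ν₁.isPostLog
  · have k : (((frobeniusTwist (L₁.prod L₂).log ν₁.isPostLog ⋙ (L₁.prod L₂).lam v ν₁) ⋙ (L₁.prod L₂).forget v) ⋙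
          (L₁.prod L₂).toE v).obj X₀ =
        (((L₁.prod L₂).lam v ν₁ ⋙ (L₁.prod L₂).forget v) ⋙ (L₁.prod L₂).toE v).obj ((L₁.prod L₂).log.obj X₀) := by
      rw [hb]; rfl
    exact eq_of_heq ((prodTS_toE_iota_heq_of_postLog L₁ L₂ hT₁ hT₂ v ε hb X₀).trans
      ((heq_comp k rfl rfl ((L₁.prod L₂).lamTwistOver_hom_app_heq_of_postLog v ν₁ hb X₀) HEq.rfl).trans
        (heq_of_eq (Category.assoc _ _ _))).symm)
  · have k : (((frobeniusTwist (L₁.prod L₂).log ν₁.isPostLog ⋙ (L₁.prod L₂).lam v ν₁) ⋙ (L₁.prod L₂).forget v) ⋙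
          (L₁.prod L₂).toE v).obj X₀ =
        (((L₁.prod L₂).lam v ν₁ ⋙ (L₁.prod L₂).forget v) ⋙ (L₁.prod L₂).toE v).obj X₀ := by
      rw [hb]; rfl
    exact eq_of_heq ((prodTS_toE_iota_heq_of_preLog L₁ L₂ hT₁ hT₂ v ε hb X₀).trans
      (heq_comp k rfl rfl ((L₁.prod L₂).lamTwistOver_hom_app_heq_of_preLog v ν₁ hb X₀) HEq.rfl).symm)

end Prod

/-! ## §6. The `TS`-data of the factors of the two-sided genuine setting, and of the setting itself -/

section TwoSided

variable (p : ℕ) [Fact p.Prime] (𝔄 : AutHolFieldFunctor.{u})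

/-- The `TS`-valued homotopy datum of abc-iut-L4-t5's `nonarchGenuineMonoAnPf p` — whose holomorphic rows ARE those of
abc-iut-w4-d095's `nonarchGenuineMono p` — : abc-iut-w4-d095's `nonarchIotaTS` at every place.
[cite: MochizukiAbsTopIII2015, Definition 5.4 (vii) p.128] -/
noncomputable def nonarchGenuineMonoAnPfTS (Vmod : Type 1) (isArc : Vmod → Bool) :
    (nonarchGenuineMonoAnPf p Vmod isArc).TSHomotopies where
  iota v _ _ ε := nonarchIotaTS p (isArc v) ε
  iota_toTS v _ _ ε := nonarchIotaTS_toTS p (isArc v) ε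

/-- its `ι` lie over `Th•[Z]` (abc-iut-L4-t3's `nonarchGenuineMonoTS_iotaOverTS`, read at the twin setting).
[cite: MochizukiAbsTopIII2015, Def 5.4 (vii) p. 128] -/
theorem nonarchGenuineMonoAnPfTS_iotaOverTS (Vmod : Type 1) (isArc : Vmod → Bool) :
    (nonarchGenuineMonoAnPfTS p Vmod isArc).IotaOverTS :=
  nonarchGenuineMonoTS_iotaOverTS p Vmod isArc

/-- The `TS`-valued homotopy datum of abc-iut-w6-d025's archimedean chart setting `archGenuineMonoAnChart 𝔄` — whose
holomorphic rows ARE those of abc-iut-w4-d095's `archGenuine 𝔄` — : abc-iut-L4-t3's `archIotaTS` at every place.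
[cite: MochizukiAbsTopIII2015, Def 5.4 (vii) p. 128] -/
noncomputable def archGenuineMonoAnChartTS (Vmod : Type (u + 1)) (isArc : Vmod → Bool) :
    (archGenuineMonoAnChart 𝔄 Vmod isArc).TSHomotopies where
  iota v _ _ ε := archIotaTS 𝔄 (isArc v) ε
  iota_toTS v _ _ ε := archIotaTS_toTS 𝔄 (isArc v) ε

/-- its `ι` lie over `Th•[Z] = EA` (abc-iut-L4-t3's `archGenuineTS_iotaOverTS`, read at the twin setting).
[cite: MochizukiAbsTopIII2015, Def 5.4 (vii) p. 128] -/
theorem archGenuineMonoAnChartTS_iotaOverTS (Vmod : Type (u + 1)) (isArc : Vmod → Bool) :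
    (archGenuineMonoAnChartTS 𝔄 Vmod isArc).IotaOverTS :=
  archGenuineTS_iotaOverTS 𝔄 Vmod isArc

variable (𝔄 : AutHolFieldFunctor.{0}) (Vmod : Type 1) (isArc : Vmod → Bool)

/-- ★ **The `TS`-valued homotopy datum of the two-sided genuine setting** `genuineTwoSided p 𝔄 V isArc` (genuine rows at BOTH
place types): the product datum of the factors'. [cite: MochizukiAbsTopIII2015, Def 5.4 (iii) p. 126] -/
noncomputable def genuineTwoSidedTS : (genuineTwoSided p 𝔄 Vmod isArc).TSHomotopies :=
  prodTS _ _ (nonarchGenuineMonoAnPfTS p Vmod isArc) (archGenuineMonoAnChartTS 𝔄 Vmod isArc)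

/-- **`IotaOver` at the two-sided genuine setting** (from abc-iut-L4-t5's `nonarchGenuineMonoAnPf_iotaOver`,
`archGenuineMonoAnChart_iotaOver`). [cite: MochizukiAbsTopIII2015, Def 5.4 (vii) p. 128] -/
theorem genuineTwoSided_iotaOver : (genuineTwoSided p 𝔄 Vmod isArc).IotaOver :=
  prod_iotaOver _ _ (nonarchGenuineMonoAnPf_iotaOver p Vmod isArc) (archGenuineMonoAnChart_iotaOver 𝔄 Vmod isArc)

/-- **`LamOverLink` at the two-sided genuine setting** (from abc-iut-L4-t5's `nonarchGenuineMonoAnPf_lamOverLink`,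
`archGenuineMonoAnChart_lamOverLink`). [cite: MochizukiAbsTopIII2015, Cor 5.5 p. 130] -/
theorem genuineTwoSided_lamOverLink : (genuineTwoSided p 𝔄 Vmod isArc).LamOverLink :=
  prod_lamOverLink _ _ (nonarchGenuineMonoAnPf_lamOverLink p Vmod isArc) (archGenuineMonoAnChart_lamOverLink 𝔄 Vmod isArc)

/-- **`IotaOverTS` for the two-sided `TS`-datum.** [cite: MochizukiAbsTopIII2015, Def 5.4 (vii) p. 128] -/
theorem genuineTwoSidedTS_iotaOverTS : (genuineTwoSidedTS p 𝔄 Vmod isArc).IotaOverTS :=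
  prodTS_iotaOverTS _ _ (nonarchGenuineMonoAnPfTS_iotaOverTS p Vmod isArc) (archGenuineMonoAnChartTS_iotaOverTS 𝔄 Vmod isArc)

end TwoSided

end LogFrobeniusSetting

end Literature.AnabelianGeometry.AbsoluteAnabelian
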